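import Literature.NumberTheory.EllipticCurves.IwasawaZpRankProofs
import Literature.NumberTheory.EllipticCurves.ZpExtensionRankProofs
import HarnessLib

/-!
# `ℤ_p`-rank of an imaginary quadratic field: the discharge (Washington, Thm. 13.4)

This leaf file discharges the named fact `zpRank_imaginaryQuadratic` of `Iwasawa.lean`
(**bsd.S22**):

* `zpRank_imaginaryQuadratic_holds` — an imaginary quadratic field `K` has `ℤ_p`-extensions
  `κ₁, κ₂` with `(κ₁, κ₂) : Γ_K → ℤ_p²` surjective and every `ℤ_p`-extension inside their
  compositum, i.e. `Gal(K̃/K) ≃ ℤ_p²` for the compositum `K̃` of all `ℤ_p`-extensions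
  (Washington, *Introduction to Cyclotomic Fields*, Thm. 13.4: `Gal(K̃/K) ≃ ℤ_p^{r₂+1+δ}`, here
  `r₂ = 1` and the Leopoldt defect `δ` is `0` vacuously, the unit group being finite; Lang,
  *Cyclotomic Fields I and II*, Ch. 5 §5 Thm. 5.2).

## The proof (as printed, and where it lives in the tree)

Washington's proof of Theorem 13.4 (§13.1, pp. 265–266) computes the `ℤ_p`-rank of
`Gal(K̃/K)` from global class field theory: `ℤ_p`-extensions are unramified outside `p`
(Prop. 13.2), the reciprocity map identifies the Galois group of the maximal abelian pro-`p`
extension unramified outside `p` — up to the finite class group — with the quotient of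
`∏_{𝔭 ∣ p} U_{1,𝔭}` by the closure of the global units (Thm. 13.4, proof; Lang, Thm. 5.1), whose
`ℤ_p`-rank is `[K:ℚ] - (r₁ + r₂ - 1 - δ) = r₂ + 1 + δ`.  In the tree this argument is
`ZpExtension.zpRank_eq_nrComplexPlaces_add_one_of_globalReciprocity`
(`ZpExtensionRankGlobalReciprocityProofs`: lower bound from the reciprocity map on
`∏_{v ∣ p} U_v`, upper bound `rank ≤ Σ_{𝔭∣p} [K_𝔭:ℚ_p] = [K:ℚ] = r₂ + 1` for unit rank `0`), fed by
the global reciprocity law `GaloisRepresentations.exists_isGlobalReciprocityMap_holds` (Artin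
reciprocity + the existence theorem, Neukirch, *Class Field Theory — The Bonn Lectures*, III
(6.6), (7.7), (7.8), (7.12); file `GlobalReciprocityExistenceProofs`) at the imaginary quadratic
models `K₀ : Type` and transported along `K ≃+* K₀`
(`ZpExtension.zpRank_eq_nrComplexPlaces_add_one_of_globalReciprocity₀`); the resulting
unconditional rank statement for unit rank `0` is `ZpExtension.zpRank_eq_nrComplexPlaces_add_one_holds`
(`ZpExtensionRankProofs`).  The imaginary quadratic statement follows by
`zpRank_imaginaryQuadratic_of_zpRank_eq` (`IwasawaZpRankProofs`: `r₂ + 1 = 2`, independence of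
two of the characters, Nakayama over `ℤ_p`).  This file only assembles these; no statement is
changed and no fact is introduced.  (The unconditional upper-bound half and the reduction of the
fact to its lower-bound half are in `IwasawaZpRankUpperBoundProofs`; the route through Lang's
Thm. 5.1 is `IwasawaZpRankUnramifiedProofs`.)

## References

* [Washington1997] L. C. Washington, *Introduction to Cyclotomic Fields*, 2nd ed., GTM 83,
  Springer 1997, §13.1: Prop. 13.2, Thm. 13.4 (pp. 264–266).
* [Lang1990] S. Lang, *Cyclotomic Fields I and II*, GTM 121, Springer 1990, Ch. 5 §5,
  Thm. 5.1, Thm. 5.2 (p. 107 of the held copy).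
* [GreenbergLNM1716] R. Greenberg, *Iwasawa theory for elliptic curves*, LNM 1716 (1999), §1.
* [Neukirch2013] J. Neukirch, *Class Field Theory — The Bonn Lectures*, Springer 2013,
  Part III §6 Thm. (6.6), §7 Thms. (7.7), (7.8), (7.12).
-/

noncomputable section

universe u

namespace Literature.NumberTheory.EllipticCurves

open Field NumberField NumberField.InfinitePlace

variable (K : Type u) [Field K] [NumberField K] (p : ℕ) [Fact p.Prime]

/-- **`ℤ_p`-rank of an imaginary quadratic field** (Washington, Thm. 13.4 with `r₂ = 1`; the
Leopoldt hypothesis of the theorem is vacuous here, the unit rank `r₁ + r₂ - 1` being `0`),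
discharging the named fact `zpRank_imaginaryQuadratic` (**bsd.S22**): an imaginary quadratic
field `K` has `ℤ_p`-extensions `κ₁, κ₂` with `(κ₁, κ₂) : Γ_K → ℤ_p × ℤ_p` surjective, and every
`ℤ_p`-extension `κ` of `K` lies in their compositum (`ker κ₁ ⊓ ker κ₂ ≤ ker κ`), i.e.
`Gal(K̃/K) ≃ ℤ_p²`.  Proof: Washington's class-field-theoretic computation of the `ℤ_p`-rank
`r₂ + 1` of a number field of unit rank `0` (`ZpExtension.zpRank_eq_nrComplexPlaces_add_one_holds`:
the global reciprocity law `GaloisRepresentations.exists_isGlobalReciprocityMap_holds`, Neukirch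
III (6.6), (7.8), (7.12), fed into `ZpExtension.zpRank_eq_nrComplexPlaces_add_one_of_globalReciprocity`
and transported to every universe), then `r₂ + 1 = 2` and the tree's
`zpRank_imaginaryQuadratic_of_zpRank_eq`.
[cite: Washington1997, §13.1 Thm. 13.4 (pp. 265–266)] [cite: Lang1990, Ch. 5 §5 Thm. 5.2]
[cite: GreenbergLNM1716, §1] -/
theorem zpRank_imaginaryQuadratic_holds : zpRank_imaginaryQuadratic K p :=
  zpRank_imaginaryQuadratic_of_zpRank_eq (ZpExtension.zpRank_eq_nrComplexPlaces_add_one_holds K p)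

end Literature.NumberTheory.EllipticCurves

end
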